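import Summits.QuantumFields.YangMills.Theorems.LuscherReductionTwistedTraceScalingRecordShadow
import Summits.QuantumFields.YangMills.Theorems.LuscherReductionTwistedTraceScalingFPWeightOrbitRep
import Summits.QuantumFields.YangMills.Theorems.LuscherReductionTwistedTraceScalingBTWindow
import HarnessLib

/-!
# The support of the record weight with a GENERAL CAP CONSTANT `Kc`, eventually: links, chart coverage, slow mean in the `(12Kc+1)β^{-s}/|Site|` window, slow action

Support file for the crux `NearFlatRatioLaw` (line `ratepack_v2`, stub `stub_hODpot_A`; successor step (E) of
`Cruxes/NearFlatRatioLaw/Lines/ratepack-v7-moments-g18.md` §14; memo v8 (g19)): lane A's `…BORecordSupport.recordChi_support` VERBATIM with the cap constant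
`43` of `recordChi L s 43 M β` replaced by a parameter `Kc ≥ 1` (the rate twin's stub uses `Kc = 42·max 1 (|Λ|/7) + 1` at `s = 1/6`); the slow-shadow constant
`517 = 12·43 + 1` becomes `12Kc + 1`, and the orbit-distance form `orbitDist (slowMean U) ≤ (12Kc+1)β^{-s}/|Site|` of the slow window (the output window of
`…CoreDefectRecordOrbitMomentsQuasi`) is exported as a sixth conjunct.
★★ `recordChi_support_K`.
-/

set_option autoImplicit false

noncomputable section

open MeasureTheory Filter Topology Real
open scoped BigOperators Matrix Quaternion
open Literature.MathematicalPhysics.QuantumFieldTheory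
open Literature.MathematicalPhysics.QuantumLattice

namespace Summit.QuantumFields.YangMills.Theorems.FemtoTransferGap.TwoLattice.ConstTube

open Summit.QuantumFields.YangMills.Theorems.FemtoTransferGap
open Summit.QuantumFields.YangMills.Theorems.FemtoTransferGap.TwoLattice
open Summit.QuantumFields.YangMills.Theorems.FemtoTransferGap.TwoLattice.Avg

variable {L : ℕ} [NeZero L]

/-- ★★ **THE SUPPORT OF THE RECORD WEIGHT WITH GENERAL CAP CONSTANT `Kc ≥ 1`, eventually in `β`** (`s > 0`, `M ≥ 0`): every `U` with `recordChi L s Kc M β U ≠ 0` has all links within `KcMβ^{-s}` of `1`,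
`orbitDist U < Kcβ^{-s}`, lies in `orthoTubeSet L`, and its slow mean satisfies `‖q((slowMean U)_k) − 1‖ ≤ (12 * Kc + 1)β^{-s}/|Site|` and `L³·S(slowMean U) ≤ β^{-2s}`.
[cite: Luscher1983, §3] -/
theorem recordChi_support_K {s : ℝ} (hs : 0 < s) {Kc : ℝ} (hKc : 1 ≤ Kc) {M : ℝ} (hM : 0 ≤ M) :
    ∀ᶠ β : ℝ in atTop, ∀ U : GaugeConfig 3 L SU2, recordChi L s Kc M β U ≠ 0 →
      (∀ e : Edge 3 L, ‖su2Quat (U e) - 1‖ ≤ M * (Kc * powScale s β)) ∧ orbitDist U < Kc * powScale s β ∧ U ∈ orthoTubeSet L ∧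
        (∀ k : Fin 3, ‖su2Quat (slowMean L U (0, k)) - 1‖ ≤ (12 * Kc + 1) / Fintype.card (Site 3 L) * powScale s β) ∧
        (L : ℝ) ^ 3 * wilsonAction su2Rep (slowMean L U) ≤ powScale (2 * s) β ∧ orbitDist (slowMean L U) ≤ (12 * Kc + 1) / Fintype.card (Site 3 L) * powScale s β := by
  set N : ℝ := (Fintype.card (Site 3 L) : ℝ) with hNdef
  have hN : 0 < N := by rw [hNdef]; exact_mod_cast Fintype.card_pos
  have hN1 : 1 ≤ N := by rw [hNdef]; exact_mod_cast Fintype.card_pos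
  have hL1 : (1 : ℝ) ≤ L := by exact_mod_cast NeZero.one_le
  have hδt := tendsto_powScale hs
  have hδ2t : Tendsto (powScale (2 * s)) atTop (𝓝 0) := tendsto_powScale (by linarith)
  -- the four eventual smallness conditions
  have c1 : (0 : ℝ) < 1 / (50 * (Kc * (M + 1)) ^ 2) := by positivity
  have c2 : (0 : ℝ) < 1 / (36 * L * N * (Kc * (M + 1)) ^ 2) := by positivity
  have c3 : (0 : ℝ) < 1 / (12 * (L : ℝ) ^ 3 * ((12 * Kc + 1) / N) ^ 4 + 1) := by positivity
  filter_upwards [hδt.eventually (gt_mem_nhds c1), hδt.eventually (gt_mem_nhds c2), hδt.eventually (gt_mem_nhds (show (0 : ℝ) < 1 / (100 * Kc) by positivity)),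
    hδ2t.eventually (gt_mem_nhds c3)] with β hβ1 hβ2 hβ3 hβ4 U hU
  set δ : ℝ := powScale s β with hδdef
  have hδ0 : 0 < δ := powScale_pos s β
  obtain ⟨-, hmem⟩ := (recordChi_props (L := L) s Kc M β).2.2.2 U hU
  have hnear : U ∈ nearOne L (M * (Kc * δ)) := hmem.1
  have hod : orbitDist U < Kc * δ := hmem.2
  have hρ0 : 0 ≤ M * (Kc * δ) := by positivity
  -- links
  have hlink : ∀ e : Edge 3 L, ‖su2Quat (U e) - 1‖ ≤ M * (Kc * δ) := fun e => by
    have h := norm_su2Quat_sub_le (U e) 1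
    rw [su2Quat_one, OneMemClass.coe_one] at h
    exact h.trans (hnear e).le
  -- chart coverage
  have hρ1 : M * (Kc * δ) ≤ Kc * (M + 1) * δ := by nlinarith
  have hρsq : (M * (Kc * δ)) ^ 2 / 4 ≤ 1 / 50 := by
    have h1 : (M * (Kc * δ)) ^ 2 ≤ (Kc * (M + 1) * δ) ^ 2 := pow_le_pow_left₀ hρ0 hρ1 2
    have h2 : (Kc * (M + 1)) ^ 2 * δ < 1 / 50 := by
      have := (lt_div_iff₀ (by positivity : (0 : ℝ) < 50 * (Kc * (M + 1)) ^ 2)).mp hβ1; linarith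
    have h3 : (Kc * (M + 1) * δ) ^ 2 = ((Kc * (M + 1)) ^ 2 * δ) * δ := by ring
    have hδ1 : δ ≤ 1 := powScale_le_one hs.le β
    nlinarith [mul_le_mul_of_nonneg_left hδ1 (by positivity : (0 : ℝ) ≤ (Kc * (M + 1)) ^ 2 * δ)]
  have hsc : ∀ e : Edge 3 L, 1 - (M * (Kc * δ)) ^ 2 / 4 ≤ scalarPart (U e) := fun e => scalarPart_ge_of_frobNorm_le (hnear e).le
  have hOT : U ∈ orthoTubeSet L := (mem_orthoTubeSet_of_near_one L (by positivity) hρsq hsc).2.1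
  -- slow shadow
  have hq : 3 * L * N * (M * (Kc * δ) + Kc * δ) ^ 2 ≤ δ / 12 := by
    have e : 3 * L * N * (M * (Kc * δ) + Kc * δ) ^ 2 = (3 * L * N * (Kc * (M + 1)) ^ 2 * δ) * δ := by ring
    rw [e]
    have h1 : 3 * L * N * (Kc * (M + 1)) ^ 2 * δ ≤ 1 / 12 := by
      have := (lt_div_iff₀ (by positivity : (0 : ℝ) < 36 * L * N * (Kc * (M + 1)) ^ 2)).mp hβ2
      nlinarith
    have := mul_le_mul_of_nonneg_right h1 hδ0.le
    linarith
  have hKδ : Kc * δ < 1 / 100 := by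
    have h := (lt_div_iff₀ (by positivity : (0 : ℝ) < 100 * Kc)).mp hβ3
    have : Kc * δ * 100 < 1 := by nlinarith
    linarith
  have hδK : δ ≤ Kc * δ := le_mul_of_one_le_left hδ0.le hKc
  have hsmall : Kc * δ + 3 * L * N * (M * (Kc * δ) + Kc * δ) ^ 2 < N / 2 := by linarith
  have hshadow := orbitDist_slowMean_le hnear hod hsmall
  have hsm : orbitDist (slowMean L U) ≤ (12 * Kc + 1) / N * δ := by
    calc orbitDist (slowMean L U) ≤ 12 * (Kc * δ + 3 * L * N * (M * (Kc * δ) + Kc * δ) ^ 2) / N := hshadow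
      _ ≤ 12 * (Kc * δ + δ / 12) / N := by gcongr
      _ = (12 * Kc + 1) / N * δ := by ring
  have hslow : ∀ k : Fin 3, ‖su2Quat (slowMean L U (0, k)) - 1‖ ≤ (12 * Kc + 1) / N * δ := fun k =>
    (norm_su2Quat_sub_one_le_orbitDist (slowMean L U) (0, k)).trans hsm
  -- slow action
  have hS := wilsonAction_one_site_le (slowMean L U) (δ := (12 * Kc + 1) / N * δ) fun e => by
    have : e = (0, e.2) := by ext <;> simp [Subsingleton.elim e.1 0]
    rw [this]; exact hslow e.2
  have hmul : powScale s β * powScale s β = powScale (2 * s) β := by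
    unfold powScale
    have h0 : 0 < max β 1 := lt_of_lt_of_le one_pos (le_max_right _ _)
    rw [← Real.rpow_add h0]; ring_nf
  have hδ4 : δ ^ 4 = powScale (2 * s) β * powScale (2 * s) β := by
    rw [hδdef, ← hmul]; ring
  have hps2 : 0 < powScale (2 * s) β := powScale_pos _ _
  have hact : (L : ℝ) ^ 3 * wilsonAction su2Rep (slowMean L U) ≤ powScale (2 * s) β := by
    have h1 : (L : ℝ) ^ 3 * wilsonAction su2Rep (slowMean L U) ≤ (L : ℝ) ^ 3 * (12 * ((12 * Kc + 1) / N * δ) ^ 4) := mul_le_mul_of_nonneg_left hS (by positivity)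
    have h2 : (L : ℝ) ^ 3 * (12 * ((12 * Kc + 1) / N * δ) ^ 4) = (12 * (L : ℝ) ^ 3 * ((12 * Kc + 1) / N) ^ 4 * powScale (2 * s) β) * powScale (2 * s) β := by
      rw [mul_pow, hδ4]; ring
    have h3 : 12 * (L : ℝ) ^ 3 * ((12 * Kc + 1) / N) ^ 4 * powScale (2 * s) β ≤ 1 := by
      have := (lt_div_iff₀ (by positivity : (0 : ℝ) < 12 * (L : ℝ) ^ 3 * ((12 * Kc + 1) / N) ^ 4 + 1)).mp hβ4
      nlinarith
    calc (L : ℝ) ^ 3 * wilsonAction su2Rep (slowMean L U) ≤ (12 * (L : ℝ) ^ 3 * ((12 * Kc + 1) / N) ^ 4 * powScale (2 * s) β) * powScale (2 * s) β := h1.trans_eq h2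
      _ ≤ 1 * powScale (2 * s) β := mul_le_mul_of_nonneg_right h3 hps2.le
      _ = powScale (2 * s) β := one_mul _
  exact ⟨hlink, hod, hOT, hslow, hact, hsm⟩

end Summit.QuantumFields.YangMills.Theorems.FemtoTransferGap.TwoLattice.ConstTube

end
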